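import Summits.AtomisticToContinuum.HydrodynamicLimit.Theses.JParityClosure
import Summits.AtomisticToContinuum.HydrodynamicLimit.Theorems.DensityCap.Negative.MollifiedDensity
import Literature.Analysis.FunctionSpaces.TorusSpaceTime
import Literature.Analysis.FluidPDE.HardSpherePhaseSpaceProofs

/-!
# drefute gen-3 — line `lipschitz-clock-free-past-cap` (crux `JParityClosure.DensityCap`, stmt-AtomisticToContinuum-13082):
kernel-checked HYPOTHESIS MUTATIONS of the registered stubs (LEAD RESHAPE v1, sha 586f0016…)

All four stubs are PROVED (A, B landed: p76245, p76778; D, E: gen-1/gen-2 candidate proofs, re-verified this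
session), so no stub is false or misstated. This file records, as theorems, which stub hypotheses are
load-bearing and which are decorative — information for the lead and for anyone re-using the stubs:

* §1 `capLimit_of_neg` — for `t < 0` the crux's conclusion block `CapLimit … t` holds trivially (the overshoot
  event is empty), so the hypothesis `ht : 0 ≤ t` of STUB E `stub_gridUpgrade` is DECORATIVE (E ⇔ E without `ht`).
* §2 `not_eulerDensityModulus_without_ht` — STUB B with `ht : t ∈ Ico 0 T` DROPPED is FALSE (beyond `T` the
  field is unconstrained junk: a field smooth on `[0,T) × 𝕋³` that jumps at a time `s ∈ (T, t]`).
* §3 `not_eulerDensityModulus_at_T` — STUB B is SHARP IN `t`: already `t = T` (i.e. `t ∈ Icc 0 T`) is FALSE for a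
  field GENUINELY smooth on `[0,T) × 𝕋³` that blows up at the shock time (`ρ(s,x) = (T − s)⁻¹`): the joint
  modulus (ii) fails on `[0, T]`. So the constants `(r₀, τ₀)` of B — hence of the cap — must degenerate as `t ↑ T`,
  and the crux's `t ∈ Ico 0 T` cannot be closed up through this line.

refuter-drefute-stmt-AtomisticToContinuum-13082-g3-0, 2026-08-16.
-/

noncomputable section

namespace DrefuteG3.Mutations

open MeasureTheory Filter Set Topology
open scoped ENNReal BigOperators
open Literature.MathematicalPhysics.KineticTheory Literature.Analysis.FluidPDE
open Literature.Analysis.FunctionSpaces (Torus.IsSmoothSpaceTimeOn Torus.stLift Torus.stLift_apply)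
open Summit.AtomisticToContinuum.HydrodynamicLimit.Theorems.DensityCapNegative
  (cone mollDensity capEvent CapLimit)
open Summit.AtomisticToContinuum.HydrodynamicLimit.Theorems.PolynomialCompressionPDE (Flows)

/-! ## §1 `ht : 0 ≤ t` of STUB E is decorative -/

/-- For `t < 0` the overshoot event is empty. -/
theorem capEvent_eq_empty_of_neg {σ : ℝ} (Φ : Flows σ) (N : ℕ) (ρ : ℝ → T3 → ℝ) {t : ℝ} (ht : t < 0)
    (η r : ℝ) : capEvent Φ N ρ t η r = ∅ := by
  refine Set.eq_empty_of_forall_notMem fun z hz => ?_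
  obtain ⟨s, hs, -⟩ := hz
  exact absurd (hs.1.trans hs.2) (not_le.2 ht)

/-- **`CapLimit` is trivial for negative times**: the hypothesis `ht : 0 ≤ t` of `stub_gridUpgrade` is not needed
for truth (it is only used to build the time net). -/
theorem capLimit_of_neg (σ : ℝ) (a₀ θ₀ : T3 → ℝ) (u₀ : T3 → V3) (Φ : Flows σ) (ρ : ℝ → T3 → ℝ) {t : ℝ}
    (ht : t < 0) : CapLimit σ a₀ u₀ θ₀ Φ ρ t := by
  intro η δ _ _
  refine ⟨1, one_pos, fun r _ _ => ⟨0, fun N _ => ?_⟩⟩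
  rw [capEvent_eq_empty_of_neg Φ N ρ ht, measure_empty]
  exact zero_le

/-! ## §2 STUB B without `ht` is false -/

/-- The conclusion of STUB B `stub_eulerDensityModulus` for a field `ρ` on `[0, t]`. -/
def ModulusConclusion (ρ : ℝ → T3 → ℝ) (t : ℝ) : Prop :=
  ∀ η : ℝ, 0 < η → ∃ r₀ : ℝ, 0 < r₀ ∧ r₀ ≤ 1 / 2 ∧
    (∀ r : ℝ, 0 < r → r < r₀ → ∀ s ∈ Icc 0 t, ∀ x : T3, ∫ y, cone r y x * ρ s y ≤ ρ s x + η) ∧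
    ∃ τ₀ : ℝ, 0 < τ₀ ∧ ∀ s ∈ Icc 0 t, ∀ s' ∈ Icc 0 t, |s - s'| ≤ τ₀ →
      ∀ x x' : T3, Torus.euclidDist x x' ≤ r₀ → |ρ s x - ρ s' x'| ≤ η

/-- STUB B with the hypothesis `ht : t ∈ Ico 0 T` dropped. -/
def EulerDensityModulusWithoutHt : Prop :=
  ∀ (T : ℝ) (ρ : ℝ → T3 → ℝ), Torus.IsSmoothSpaceTimeOn (Ico 0 T) ρ → ∀ t : ℝ, ModulusConclusion ρ t

/-- A time-step field: `0` before time `a`, `1` from time `a` on (constant in space). -/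
def stepField (a : ℝ) : ℝ → T3 → ℝ := fun s _ => if s < a then 0 else 1

theorem stepField_smooth {T a : ℝ} (hTa : T ≤ a) : Torus.IsSmoothSpaceTimeOn (Ico 0 T) (stepField a) := by
  change ContDiffOn ℝ _ (Torus.stLift (stepField a)) (Ico 0 T ×ˢ univ)
  refine (contDiffOn_const (c := (0 : ℝ))).congr fun p hp => ?_
  obtain ⟨hp1, -⟩ := Set.mem_prod.1 hp
  have : p.1 < a := lt_of_lt_of_le hp1.2 hTa
  show stepField a p.1 _ = 0
  simp [stepField, this]

/-- The modulus conclusion fails on `[0, t]` for the step field jumping at `a ∈ (0, t]`. -/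
theorem not_modulusConclusion_stepField {a t : ℝ} (ha : 0 < a) (hat : a ≤ t) :
    ¬ ModulusConclusion (stepField a) t := by
  intro h
  obtain ⟨r₀, hr₀, -, -, τ₀, hτ₀, hmod⟩ := h (1 / 2) (by norm_num)
  set s' : ℝ := a - min τ₀ a with hs'
  have hmin_pos : 0 < min τ₀ a := lt_min hτ₀ ha
  have hmin_le : min τ₀ a ≤ a := min_le_right _ _
  have hs'mem : s' ∈ Icc 0 t := ⟨by rw [hs']; linarith, by rw [hs']; linarith⟩
  have hamem : a ∈ Icc 0 t := ⟨ha.le, hat⟩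
  have hdist : |a - s'| ≤ τ₀ := by
    rw [hs', show a - (a - min τ₀ a) = min τ₀ a by ring, abs_of_pos hmin_pos]
    exact min_le_left _ _
  have key := hmod a hamem s' hs'mem hdist (0 : T3) 0 (by rw [Torus.euclidDist_self]; exact hr₀.le)
  have h1 : stepField a a (0 : T3) = 1 := by simp [stepField]
  have h2 : stepField a s' (0 : T3) = 0 := by
    have : s' < a := by rw [hs']; linarith
    simp [stepField, this]
  rw [h1, h2] at key
  norm_num at key

/-- **STUB B without `ht` is FALSE**: witness `T = 1`, `t = 2`, the step field jumping at `a = 3/2` (smooth — indeed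
`≡ 0` — on `[0,1) × 𝕋³`, junk beyond `T`). So `ht` (precisely its half `t < T`) is load-bearing. -/
theorem not_eulerDensityModulus_without_ht : ¬ EulerDensityModulusWithoutHt := fun h =>
  not_modulusConclusion_stepField (a := 3 / 2) (t := 2) (by norm_num) (by norm_num)
    (h 1 (stepField (3 / 2)) (stepField_smooth (by norm_num)) 2)

/-! ## §3 STUB B is sharp: `t = T` is false for a genuine blow-up at the shock time -/

/-- STUB B with `t ∈ Icc 0 T` (closed) in place of `t ∈ Ico 0 T`. -/
def EulerDensityModulusClosed : Prop :=
  ∀ (T : ℝ) (ρ : ℝ → T3 → ℝ), Torus.IsSmoothSpaceTimeOn (Ico 0 T) ρ → ∀ t ∈ Icc 0 T, ModulusConclusion ρ t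

/-- The blow-up field `ρ(s, x) = (T − s)⁻¹` (constant in space; `0` at `s = T` by `inv_zero`). -/
def blowupField (T : ℝ) : ℝ → T3 → ℝ := fun s _ => (T - s)⁻¹

/-- The blow-up field is genuinely smooth on `[0, T) × 𝕋³`. -/
theorem blowupField_smooth (T : ℝ) : Torus.IsSmoothSpaceTimeOn (Ico 0 T) (blowupField T) := by
  change ContDiffOn ℝ _ (Torus.stLift (blowupField T)) (Ico 0 T ×ˢ univ)
  have h : ContDiffOn ℝ ⊤ (fun p : ℝ × EuclideanSpace ℝ (Fin 3) => (T - p.1)⁻¹) (Ico 0 T ×ˢ univ) := by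
    refine (contDiffOn_const.sub contDiffOn_fst).inv fun p hp => ?_
    obtain ⟨hp1, -⟩ := Set.mem_prod.1 hp
    exact ne_of_gt (sub_pos.2 hp1.2)
  exact (h.of_le le_top).congr fun p _ => rfl

/-- The modulus conclusion fails on `[0, T]` for the blow-up field (`T > 0`). -/
theorem not_modulusConclusion_blowupField {T : ℝ} (hT : 0 < T) : ¬ ModulusConclusion (blowupField T) T := by
  intro h
  obtain ⟨r₀, hr₀, -, -, τ₀, hτ₀, hmod⟩ := h 1 one_pos
  set m : ℝ := min τ₀ (min T (1 / 2)) with hm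
  have hm_pos : 0 < m := lt_min hτ₀ (lt_min hT (by norm_num))
  have hm_leτ : m ≤ τ₀ := min_le_left _ _
  have hm_leT : m ≤ T := (min_le_right _ _).trans (min_le_left _ _)
  have hm_le2 : m ≤ 1 / 2 := (min_le_right _ _).trans (min_le_right _ _)
  have hTmem : T ∈ Icc 0 T := ⟨hT.le, le_rfl⟩
  have hs'mem : T - m ∈ Icc 0 T := ⟨by linarith, by linarith⟩
  have hdist : |T - (T - m)| ≤ τ₀ := by
    rw [show T - (T - m) = m by ring, abs_of_pos hm_pos]
    exact hm_leτ
  have key := hmod T hTmem (T - m) hs'mem hdist (0 : T3) 0 (by rw [Torus.euclidDist_self]; exact hr₀.le)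
  have h1 : blowupField T T (0 : T3) = 0 := by simp [blowupField]
  have h2 : blowupField T (T - m) (0 : T3) = m⁻¹ := by simp [blowupField]
  rw [h1, h2, zero_sub, abs_neg, abs_of_pos (inv_pos.2 hm_pos)] at key
  have : (2 : ℝ) ≤ m⁻¹ := by
    rw [le_inv_comm₀ (by norm_num) hm_pos]
    linarith
  linarith

/-- **STUB B at `t = T` is FALSE** (witness `T = 1`, `ρ = (1 − s)⁻¹`, smooth on `[0,1) × 𝕋³`): the joint modulus
cannot hold up to the shock time, so B's `t < T` is sharp and the cap's constants degenerate as `t ↑ T`. -/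
theorem not_eulerDensityModulus_at_T : ¬ EulerDensityModulusClosed := fun h =>
  not_modulusConclusion_blowupField one_pos (h 1 (blowupField 1) (blowupField_smooth 1) 1 ⟨zero_le_one, le_rfl⟩)

end DrefuteG3.Mutations

end
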